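import Literature.Geometry.Lorentzian.KerrDeSitterSurfaceGravities
import Literature.Analysis.ODE.HeunDerivative
import HarnessLib

/-!
# The Kerr–de Sitter radial Teukolsky equation in Heun form (Hatsuda 2020 (2.15)–(2.21) =
# Suzuki–Takasugi–Umetsu 1998 (3.8)–(3.10)): the three coefficient identities, kernel-checked

Source read verbatim: Y. Hatsuda, *Quasinormal modes of Kerr–de Sitter black holes via the Heun
function*, Class. Quantum Grav. 38 (2020) 025015 = arXiv:2006.08957 [Hatsuda2020], §2.2,
(2.13)–(2.22) and (3.2); H. Suzuki, E. Takasugi, H. Umetsu, Prog. Theor. Phys. 100 (1998) 491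
= arXiv:gr-qc/9805064 [SuzukiTakasugiUmetsu1998], §3.2 (3.7)–(3.10).

Printed (Hatsuda (2.15)–(2.21), `Q = 0`): with the Möbius map
`z = (r₊' − r₋)(r − r₊)/((r₊' − r₊)(r − r₋))`, sending `(r₊, r₊', r₋, r₋', ∞) ↦ (0, 1, ∞, z_r, z_∞)`,
`z_r = z(r₋')`, `z_∞ = (r₊'−r₋)/(r₊'−r₊)`, and the s-homotopic substitution
`R = z^{B₁}(z−1)^{B₂}(z−z_r)^{B₃}(z−z_∞)^{2s+1} y(z)`, `B_j = i(1+α)K(r_j)/Δ_r'(r_j)`, the radial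
Teukolsky equation (2.13) becomes Heun's equation
`y'' + (γ/z + δ/(z−1) + ε/(z−z_r)) y' + (σ₊σ₋ z + v)/(z(z−1)(z−z_r)) y = 0` with
`γ = 2B₁+s+1`, `δ = 2B₂+s+1`, `ε = 2B₃+s+1`, `σ₊ = 2s+1`, `σ₋ = s+1 − 2i(1+α)K(r₋)/Δ_r'(r₋)` and
`v = (1+s)(1+2s)r₋'/(r₋−r₋') + [3λ − 2s(3−a²Λ) + Λ(1+s)(1+2s)r₊(r₊+r₊')]/(Λ(r₋−r₋')(r₊−r₊'))`
`− 2i(1+2s)(3+a²Λ)(r₊r₋ω + a²ω − am)/(Λ(r₋−r₋')(r₋−r₊)(r₊−r₊'))`, "using `r₊ + r₊' + r₋ + r₋' = 0`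
and `Σ_h K(r_h)/Δ_r'(r_h) = 0`" (2.22); Heun data (3.2): `a = z_r`, `q = −v`, `α = σ₊`, `β = σ₋`.

## What this file proves (0 facts; the pub-kds cell previously had this only as a sympy check at
## four rational geometries, HOME/lit/kds_heun_ts_check.py)

In the tree's vocabulary (`delta`, `deltaDeriv`, `radialK`, `horizonB`, `radialPotential` of
`KerrDeSitterTeukolskyRadial.lean`; roots `rMinus = r₋ ↦ ∞`, `rPlus = r₊ ↦ 0`, `rCosmo = r₊' ↦ 1`,
`rNeg = r₋' ↦ z_r`; Umetsu's operator `GeneralHeun.lead/mid/low` of `HeunDerivative.lean`, whose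
`low α β q = αβ z + q` carries `q` with Hatsuda's sign of `v`), for subextremal parameters and every
`r ∈ (r₊, r_c)`, writing `z = mobiusZ`, `z' , z''` for its derivatives, `L = iΞK/Δ_r − (2s+1)/(r−r₋)`
(the logarithmic `r`-derivative of Hatsuda's weight, `heunL`; see `heunL_eq_sum` for the
partial-fraction form `Σ_j B_j/(r−r_j) − (2s+1)/(r−r₋)`) and `Φ = (Λ/3)(r_c − r₊)(r₋ − r₋')`:
* `heun_lead_identity`:  `Δ_r · z'² = Φ · z(z−1)(z−z_r)`;
* `heun_mid_identity`:   `Δ_r z'' + (2Δ_r L + (s+1)Δ_r') z' = Φ · [γ(z−1)(z−z_r) + δz(z−z_r) + εz(z−1)]`;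
* `heun_low_identity`:   `Δ_r(L² + L') + (s+1)Δ_r' L + V = Φ · (σ₊σ₋ z + v)`,
`V` the zeroth-order coefficient of (2.13) (`radialPotential`). These are exactly the statements
that `R = w · y(z(r))` with `w'/w = L` solves `Δ_r R'' + (s+1)Δ_r'R' + VR = 0` iff `y` solves
Hatsuda's Heun equation (chain rule: `ΔR'' + (s+1)Δ'R' + VR = w·[Δz'² y'' + (Δz'' + (2ΔL + (s+1)Δ')z')y'`
`+ (Δ(L²+L') + (s+1)Δ'L + V)y]`). Also proved: the Fuchs relation `γ+δ+ε = σ₊+σ₋+1`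
(`heun_fuchs`, from `Σ_j B_j = 0`, (2.22)), `hasDerivAt_mobiusZ`, `hasDerivAt_heunL`, and the
partial-fraction identity `iΞK/Δ_r = Σ_j B_j/(r−r_j)` (`heunL_eq_sum`). The mechanism of the
"apparent and removable" singularity at `z_∞` (Hatsuda, below (2.14)) is visible in the proof of
`heun_low_identity`: the `Ξ²K²/Δ_r` and `ΞKΔ_r'/Δ_r` terms cancel identically (`heun_low_cancel`)
and the `r²` terms cancel against `(2Λ/3)(s+1)(2s+1)r²`.
-- TODO(general form): the assembled equivalence `IsRadialTeukolskySolution ↔ GeneralHeun.IsSolutionOn`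
-- for `y = (R/w) ∘ z⁻¹` (complex powers of the weight), as in the Kerr file `TeukolskyRadialHeunForm`.
-/

noncomputable section

open Complex Set

namespace Literature.Geometry.Lorentzian.KerrDeSitter

open Literature.Analysis.ODE

/-! ### The Möbius map of Hatsuda (2.15) and its derivatives -/

/-- Hatsuda's Möbius variable `z = (r₊' − r₋)(r − r₊)/((r₊' − r₊)(r − r₋))`
(`r₊ ↦ 0`, `r₊' = r_c ↦ 1`, `r₋ ↦ ∞`). [cite: Hatsuda2020, (2.15)] -/
def mobiusZ (M a Λ r : ℝ) : ℝ :=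
  (rCosmo M a Λ - rMinus M a Λ) * (r - rPlus M a Λ) / ((rCosmo M a Λ - rPlus M a Λ) * (r - rMinus M a Λ))

/-- `z_r = z(r₋')`, the image of the negative root. [cite: Hatsuda2020, (2.16)] -/
def mobiusZr (M a Λ : ℝ) : ℝ := mobiusZ M a Λ (rNeg M a Λ)

/-- `z_∞ = (r₊' − r₋)/(r₊' − r₊)`, the image of `r = ∞`. [cite: Hatsuda2020, (2.16)] -/
def mobiusZinf (M a Λ : ℝ) : ℝ := (rCosmo M a Λ - rMinus M a Λ) / (rCosmo M a Λ - rPlus M a Λ)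

/-- `dz/dr = (r₊' − r₋)(r₊ − r₋)/((r₊' − r₊)(r − r₋)²)`. [cite: Hatsuda2020, (2.15)] -/
def mobiusZDeriv (M a Λ r : ℝ) : ℝ :=
  (rCosmo M a Λ - rMinus M a Λ) * (rPlus M a Λ - rMinus M a Λ) /
    ((rCosmo M a Λ - rPlus M a Λ) * (r - rMinus M a Λ) ^ 2)

/-- `d²z/dr² = −2(r₊' − r₋)(r₊ − r₋)/((r₊' − r₊)(r − r₋)³)`. [cite: Hatsuda2020, (2.15)] -/
def mobiusZDeriv2 (M a Λ r : ℝ) : ℝ :=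
  -2 * (rCosmo M a Λ - rMinus M a Λ) * (rPlus M a Λ - rMinus M a Λ) /
    ((rCosmo M a Λ - rPlus M a Λ) * (r - rMinus M a Λ) ^ 3)

/-- `dz/dr` (quotient rule). [cite: Hatsuda2020, (2.15)] -/
theorem hasDerivAt_mobiusZ {M a Λ : ℝ} (hsub : IsSubextremal M a Λ) {r : ℝ} (hr : r ≠ rMinus M a Λ) :
    HasDerivAt (mobiusZ M a Λ) (mobiusZDeriv M a Λ r) r := by
  obtain ⟨-, -, h01, h12, -⟩ := hsub
  have hx : r - rMinus M a Λ ≠ 0 := sub_ne_zero.2 hr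
  have hc : rCosmo M a Λ - rPlus M a Λ ≠ 0 := by linarith
  have h := (((hasDerivAt_id r).sub_const (rPlus M a Λ)).div
    ((hasDerivAt_id r).sub_const (rMinus M a Λ)) hx).const_mul
    ((rCosmo M a Λ - rMinus M a Λ) / (rCosmo M a Λ - rPlus M a Λ))
  have e : mobiusZ M a Λ = fun t => (rCosmo M a Λ - rMinus M a Λ) / (rCosmo M a Λ - rPlus M a Λ) *
      ((t - rPlus M a Λ) / (t - rMinus M a Λ)) := by
    funext t; unfold mobiusZ; rw [mul_div_mul_comm]
  rw [e]
  refine h.congr_deriv ?_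
  unfold mobiusZDeriv
  simp only [id]
  field_simp
  ring

/-- `d²z/dr²`. [cite: Hatsuda2020, (2.15)] -/
theorem hasDerivAt_mobiusZDeriv {M a Λ : ℝ} (hsub : IsSubextremal M a Λ) {r : ℝ}
    (hr : r ≠ rMinus M a Λ) :
    HasDerivAt (mobiusZDeriv M a Λ) (mobiusZDeriv2 M a Λ r) r := by
  obtain ⟨-, -, h01, h12, -⟩ := hsub
  have hx : r - rMinus M a Λ ≠ 0 := sub_ne_zero.2 hr
  have hc : rCosmo M a Λ - rPlus M a Λ ≠ 0 := by linarith
  have h2 : HasDerivAt (fun t : ℝ => (t - rMinus M a Λ) ^ 2) (((2 : ℕ) : ℝ) * (r - rMinus M a Λ) ^ (2 - 1) * 1) r :=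
    ((hasDerivAt_id r).sub_const (rMinus M a Λ)).pow 2
  have h := (hasDerivAt_const r
    ((rCosmo M a Λ - rMinus M a Λ) * (rPlus M a Λ - rMinus M a Λ) / (rCosmo M a Λ - rPlus M a Λ))).div
    h2 (pow_ne_zero 2 hx)
  have e : mobiusZDeriv M a Λ = fun t => (rCosmo M a Λ - rMinus M a Λ) * (rPlus M a Λ - rMinus M a Λ) /
      (rCosmo M a Λ - rPlus M a Λ) / (t - rMinus M a Λ) ^ 2 := by
    funext t; unfold mobiusZDeriv; rw [div_mul_eq_div_div]
  rw [e]
  refine h.congr_deriv ?_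
  unfold mobiusZDeriv2
  field_simp
  ring

/-- `z(r₊) = 0`. [cite: Hatsuda2020, (2.15)–(2.16)] -/
theorem mobiusZ_rPlus (M a Λ : ℝ) : mobiusZ M a Λ (rPlus M a Λ) = 0 := by simp [mobiusZ]

/-- `z(r_c) = 1` on subextremal parameters. [cite: Hatsuda2020, (2.15)–(2.16)] -/
theorem mobiusZ_rCosmo {M a Λ : ℝ} (hsub : IsSubextremal M a Λ) : mobiusZ M a Λ (rCosmo M a Λ) = 1 := by
  obtain ⟨-, -, h01, h12, -⟩ := hsub
  have h1 : rCosmo M a Λ - rPlus M a Λ ≠ 0 := by linarith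
  have h2 : rCosmo M a Λ - rMinus M a Λ ≠ 0 := by linarith
  unfold mobiusZ
  field_simp

/-! ### Hatsuda's Heun parameters (2.20)–(2.21), (3.2) -/

/-- `γ = 2B₁ + s + 1`, `B₁ = B(r₊)`. [cite: Hatsuda2020, (2.20)] -/
def heunGamma (M a Λ s : ℝ) (ω : ℂ) (m : ℝ) : ℂ := 2 * horizonB M a Λ ω m (rPlus M a Λ) + s + 1

/-- `δ = 2B₂ + s + 1`, `B₂ = B(r₊')`. [cite: Hatsuda2020, (2.20)] -/
def heunDelta (M a Λ s : ℝ) (ω : ℂ) (m : ℝ) : ℂ := 2 * horizonB M a Λ ω m (rCosmo M a Λ) + s + 1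

/-- `ε = 2B₃ + s + 1`, `B₃ = B(r₋')`. [cite: Hatsuda2020, (2.20)] -/
def heunEps (M a Λ s : ℝ) (ω : ℂ) (m : ℝ) : ℂ := 2 * horizonB M a Λ ω m (rNeg M a Λ) + s + 1

/-- `σ₊ = 2s + 1` (Heun's `α`). [cite: Hatsuda2020, (2.20) and (3.2)] -/
def heunSigmaPlus (s : ℝ) : ℂ := 2 * s + 1

/-- `σ₋ = s + 1 − 2i(1+α)K(r₋)/Δ_r'(r₋) = s + 1 − 2B(r₋)` (Heun's `β`). [cite: Hatsuda2020, (2.20) and (3.2)] -/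
def heunSigmaMinus (M a Λ s : ℝ) (ω : ℂ) (m : ℝ) : ℂ := s + 1 - 2 * horizonB M a Λ ω m (rMinus M a Λ)

/-- Hatsuda's accessory quantity `v` of (2.21) (Heun's `q = −v` in the DLMF sign; `= v` in Umetsu's
`low α β q = αβ z + q`), with `3 − a²Λ = 3(1−α)` and `3 + a²Λ = 3Ξ`:
`v = (1+s)(1+2s)r₋'/(r₋−r₋') + [3λ − 6s(1−α) + Λ(1+s)(1+2s)r₊(r₊+r₊')]/(Λ(r₋−r₋')(r₊−r₊'))`
`− 6iΞ(1+2s)(r₊r₋ω + a²ω − am)/(Λ(r₋−r₋')(r₋−r₊)(r₊−r₊'))`. [cite: Hatsuda2020, (2.21)] -/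
def heunV (M a Λ s : ℝ) (ω : ℂ) (m : ℝ) (lam : ℂ) : ℂ :=
  (((1 + s) * (1 + 2 * s) * rNeg M a Λ / (rMinus M a Λ - rNeg M a Λ) : ℝ) : ℂ) +
    (3 * lam - ((6 * s * (1 - alpha a Λ) : ℝ) : ℂ) +
        ((Λ * (1 + s) * (1 + 2 * s) * rPlus M a Λ * (rPlus M a Λ + rCosmo M a Λ) : ℝ) : ℂ)) /
      ((Λ * (rMinus M a Λ - rNeg M a Λ) * (rPlus M a Λ - rCosmo M a Λ) : ℝ) : ℂ) -
    6 * I * (xi a Λ : ℂ) * (1 + 2 * (s : ℂ)) *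
        (((rPlus M a Λ * rMinus M a Λ : ℝ) : ℂ) * ω + ((a ^ 2 : ℝ) : ℂ) * ω - ((a * m : ℝ) : ℂ)) /
      ((Λ * (rMinus M a Λ - rNeg M a Λ) * (rMinus M a Λ - rPlus M a Λ) *
        (rPlus M a Λ - rCosmo M a Λ) : ℝ) : ℂ)

/-- The constant `Φ = (Λ/3)(r_c − r₊)(r₋ − r₋') = Δ_r z'²/(z(z−1)(z−z_r))` relating the two operators.
[cite: Hatsuda2020, (2.15)–(2.19)] -/
def heunPhi (M a Λ : ℝ) : ℝ := Λ / 3 * (rCosmo M a Λ - rPlus M a Λ) * (rMinus M a Λ - rNeg M a Λ)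

/-- The logarithmic `r`-derivative of Hatsuda's weight `z^{B₁}(z−1)^{B₂}(z−z_r)^{B₃}(z−z_∞)^{2s+1}`,
in closed form `L = iΞK/Δ_r − (2s+1)/(r − r₋)` (partial fractions, `heunL_eq_sum`). [cite: Hatsuda2020, (2.17)–(2.18)] -/
def heunL (M a Λ s : ℝ) (ω : ℂ) (m : ℝ) (r : ℝ) : ℂ :=
  I * (xi a Λ : ℂ) * radialK a ω m r / (delta M a Λ r : ℂ) - (2 * s + 1) / ((r - rMinus M a Λ : ℝ) : ℂ)

/-- `L' = iΞ(K'Δ_r − KΔ_r')/Δ_r² + (2s+1)/(r−r₋)²`, `K' = 2ωr`. [cite: Hatsuda2020, (2.17)–(2.18)] -/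
def heunLDeriv (M a Λ s : ℝ) (ω : ℂ) (m : ℝ) (r : ℝ) : ℂ :=
  I * (xi a Λ : ℂ) * (2 * ω * (r : ℂ) * (delta M a Λ r : ℂ) - radialK a ω m r * (deltaDeriv M a Λ r : ℂ)) /
      (delta M a Λ r : ℂ) ^ 2 + (2 * s + 1) / ((r - rMinus M a Λ : ℝ) : ℂ) ^ 2

/-! ### Root algebra: `Δ_r'` in product form, positions of `r ∈ (r₊, r_c)` -/

/-- `Δ_r'(r)` in terms of the roots (derivative of the product form `delta_eq_prod`): with
`x = r₋, y = r₊, z = r_c`, `w = −(x+y+z)`,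
`Δ_r'(r) = −(Λ/3)[(r−y)(r−z)(r−w) + (r−x)(r−z)(r−w) + (r−x)(r−y)(r−w) + (r−x)(r−y)(r−z)]`.
[cite: CasalsTeixeiradacosta2022, (3.2)] -/
theorem deltaDeriv_eq_prod {M a Λ : ℝ} (hsub : IsSubextremal M a Λ) (r : ℝ) :
    deltaDeriv M a Λ r = -(Λ / 3) *
      ((r - rPlus M a Λ) * (r - rCosmo M a Λ) * (r - rNeg M a Λ) +
        (r - rMinus M a Λ) * (r - rCosmo M a Λ) * (r - rNeg M a Λ) +
        (r - rMinus M a Λ) * (r - rPlus M a Λ) * (r - rNeg M a Λ) +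
        (r - rMinus M a Λ) * (r - rPlus M a Λ) * (r - rCosmo M a Λ)) := by
  have h1 := vieta_sq hsub
  have h2 := vieta_M hsub
  simp only [deltaDeriv, rNeg]
  linear_combination (2 * r) * h1 - h2

/-- `Δ_r'(r₊) = −(Λ/3)(r₊−r₋)(r₊−r_c)(r₊−r₋')`. [cite: CasalsTeixeiradacosta2022, (3.10)] -/
theorem deltaDeriv_at_rPlus {M a Λ : ℝ} (hsub : IsSubextremal M a Λ) :
    deltaDeriv M a Λ (rPlus M a Λ) = -(Λ / 3) * ((rPlus M a Λ - rMinus M a Λ) *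
      (rPlus M a Λ - rCosmo M a Λ) * (rPlus M a Λ - rNeg M a Λ)) := by
  rw [deltaDeriv_eq_prod hsub]; ring

/-- `Δ_r'(r_c) = −(Λ/3)(r_c−r₋)(r_c−r₊)(r_c−r₋')`. [cite: CasalsTeixeiradacosta2022, (3.10)] -/
theorem deltaDeriv_at_rCosmo {M a Λ : ℝ} (hsub : IsSubextremal M a Λ) :
    deltaDeriv M a Λ (rCosmo M a Λ) = -(Λ / 3) * ((rCosmo M a Λ - rMinus M a Λ) *
      (rCosmo M a Λ - rPlus M a Λ) * (rCosmo M a Λ - rNeg M a Λ)) := by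
  rw [deltaDeriv_eq_prod hsub]; ring

/-- `Δ_r'(r₋) = −(Λ/3)(r₋−r₊)(r₋−r_c)(r₋−r₋')`. [cite: CasalsTeixeiradacosta2022, (3.10)] -/
theorem deltaDeriv_at_rMinus {M a Λ : ℝ} (hsub : IsSubextremal M a Λ) :
    deltaDeriv M a Λ (rMinus M a Λ) = -(Λ / 3) * ((rMinus M a Λ - rPlus M a Λ) *
      (rMinus M a Λ - rCosmo M a Λ) * (rMinus M a Λ - rNeg M a Λ)) := by
  rw [deltaDeriv_eq_prod hsub]; ring

/-- `Δ_r'(r₋') = −(Λ/3)(r₋'−r₋)(r₋'−r₊)(r₋'−r_c)`. [cite: CasalsTeixeiradacosta2022, (3.10)] -/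
theorem deltaDeriv_at_rNeg {M a Λ : ℝ} (hsub : IsSubextremal M a Λ) :
    deltaDeriv M a Λ (rNeg M a Λ) = -(Λ / 3) * ((rNeg M a Λ - rMinus M a Λ) *
      (rNeg M a Λ - rPlus M a Λ) * (rNeg M a Λ - rCosmo M a Λ)) := by
  rw [deltaDeriv_eq_prod hsub]; ring

/-- Elementary positions for `r ∈ (r₊, r_c)` on subextremal parameters: all the differences that
appear as denominators are non-zero. [folklore] -/
private theorem root_facts {M a Λ : ℝ} (hsub : IsSubextremal M a Λ) {r : ℝ}
    (hr : r ∈ Ioo (rPlus M a Λ) (rCosmo M a Λ)) :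
    0 < Λ ∧ rMinus M a Λ < rPlus M a Λ ∧ rPlus M a Λ < rCosmo M a Λ ∧ rNeg M a Λ < rMinus M a Λ ∧
      rPlus M a Λ < r ∧ r < rCosmo M a Λ ∧ 0 < delta M a Λ r := by
  have h0 := rMinus_nonneg M a Λ
  obtain ⟨hM, hΛ, h01, h12, -, -, -, hpos, -⟩ := hsub
  refine ⟨hΛ, h01, h12, ?_, hr.1, hr.2, hpos r hr⟩
  simp only [rNeg]
  linarith

/-! ### The Fuchs relation and the partial-fraction form of `L` -/

/-- `Σ_h B(r_h) = 0` over the four roots ("`Σ_h K(r_h)/Δ_r'(r_h) = 0`", since `deg K = 2 < 3`).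
[cite: Hatsuda2020, (2.22)] -/
theorem horizonB_sum {M a Λ : ℝ} (hsub : IsSubextremal M a Λ) (ω : ℂ) (m : ℝ) :
    horizonB M a Λ ω m (rPlus M a Λ) + horizonB M a Λ ω m (rCosmo M a Λ) +
      horizonB M a Λ ω m (rNeg M a Λ) + horizonB M a Λ ω m (rMinus M a Λ) = 0 := by
  have hdy := deltaDeriv_at_rPlus hsub
  have hdz := deltaDeriv_at_rCosmo hsub
  have hdw := deltaDeriv_at_rNeg hsub
  have hdx := deltaDeriv_at_rMinus hsub
  unfold horizonB radialK
  rw [hdy, hdz, hdw, hdx]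
  have h0 := rMinus_nonneg M a Λ
  have hw : rNeg M a Λ = -(rMinus M a Λ + rPlus M a Λ + rCosmo M a Λ) := rfl
  rw [hw]
  obtain ⟨hM, hΛ, h01, h12, -⟩ := hsub
  set x := rMinus M a Λ with hx
  set y := rPlus M a Λ with hy
  set zc := rCosmo M a Λ with hzc
  have hxy : (x : ℂ) - y ≠ 0 := by exact_mod_cast (show x - y ≠ 0 by linarith)
  have hxz : (x : ℂ) - zc ≠ 0 := by exact_mod_cast (show x - zc ≠ 0 by linarith)
  have hyz : (y : ℂ) - zc ≠ 0 := by exact_mod_cast (show y - zc ≠ 0 by linarith)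
  have hyx : (y : ℂ) - x ≠ 0 := by exact_mod_cast (show y - x ≠ 0 by linarith)
  have hzx : (zc : ℂ) - x ≠ 0 := by exact_mod_cast (show zc - x ≠ 0 by linarith)
  have hzy : (zc : ℂ) - y ≠ 0 := by exact_mod_cast (show zc - y ≠ 0 by linarith)
  have hxw : (x : ℂ) - -(x + y + zc) ≠ 0 := by exact_mod_cast (show x - -(x + y + zc) ≠ 0 by linarith)
  have hyw : (y : ℂ) - -(x + y + zc) ≠ 0 := by exact_mod_cast (show y - -(x + y + zc) ≠ 0 by linarith)
  have hzw : (zc : ℂ) - -(x + y + zc) ≠ 0 := by exact_mod_cast (show zc - -(x + y + zc) ≠ 0 by linarith)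
  have hwx : (-(x + y + zc) : ℂ) - x ≠ 0 := by exact_mod_cast (show -(x + y + zc) - x ≠ 0 by linarith)
  have hwy : (-(x + y + zc) : ℂ) - y ≠ 0 := by exact_mod_cast (show -(x + y + zc) - y ≠ 0 by linarith)
  have hwz : (-(x + y + zc) : ℂ) - zc ≠ 0 := by exact_mod_cast (show -(x + y + zc) - zc ≠ 0 by linarith)
  have hΛ' : (Λ : ℂ) ≠ 0 := by exact_mod_cast hΛ.ne'
  push_cast
  field_simp
  ring

/-- **Fuchs relation** `γ + δ + ε = σ₊ + σ₋ + 1` of Hatsuda's Heun data. [cite: Hatsuda2020, (2.20) and (3.2)] -/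
theorem heun_fuchs {M a Λ : ℝ} (hsub : IsSubextremal M a Λ) (s : ℝ) (ω : ℂ) (m : ℝ) :
    heunGamma M a Λ s ω m + heunDelta M a Λ s ω m + heunEps M a Λ s ω m =
      heunSigmaPlus s + heunSigmaMinus M a Λ s ω m + 1 := by
  have h := horizonB_sum hsub ω m
  unfold heunGamma heunDelta heunEps heunSigmaPlus heunSigmaMinus
  linear_combination 2 * h

/-- **Partial fractions**: `iΞK(r)/Δ_r(r) = Σ_j B(r_j)/(r − r_j)` over the four roots (`deg K = 2 < 4`,
simple roots), hence `L = Σ_{j} B_j/(r−r_j) − (2s+1)/(r−r₋)` — the logarithmic `r`-derivative of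
`z^{B₁}(z−1)^{B₂}(z−z_r)^{B₃}(z−z_∞)^{2s+1}` (`d/dr log(z−z_j) = 1/(r−r_j) − 1/(r−r₋)`,
`d/dr log(z−z_∞) = −1/(r−r₋)`, `B₁+B₂+B₃ = −B(r₋)`). [cite: Hatsuda2020, (2.17)–(2.18) and (2.22)] -/
theorem heunL_eq_sum {M a Λ : ℝ} (hsub : IsSubextremal M a Λ) (s : ℝ) (ω : ℂ) (m : ℝ) {r : ℝ}
    (hr : r ∈ Ioo (rPlus M a Λ) (rCosmo M a Λ)) :
    heunL M a Λ s ω m r =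
      horizonB M a Λ ω m (rPlus M a Λ) / ((r - rPlus M a Λ : ℝ) : ℂ) +
        horizonB M a Λ ω m (rCosmo M a Λ) / ((r - rCosmo M a Λ : ℝ) : ℂ) +
        horizonB M a Λ ω m (rNeg M a Λ) / ((r - rNeg M a Λ : ℝ) : ℂ) +
        horizonB M a Λ ω m (rMinus M a Λ) / ((r - rMinus M a Λ : ℝ) : ℂ) -
        (2 * s + 1) / ((r - rMinus M a Λ : ℝ) : ℂ) := by
  have hΔ := delta_eq_prod hsub r
  have hdy := deltaDeriv_at_rPlus hsub
  have hdz := deltaDeriv_at_rCosmo hsub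
  have hdw := deltaDeriv_at_rNeg hsub
  have hdx := deltaDeriv_at_rMinus hsub
  unfold heunL horizonB radialK
  rw [hdy, hdz, hdw, hdx, hΔ]
  obtain ⟨hΛ, h01, h12, hw0, hr1, hr2, hΔpos⟩ := root_facts hsub hr
  have hw : rNeg M a Λ = -(rMinus M a Λ + rPlus M a Λ + rCosmo M a Λ) := rfl
  rw [hw] at hw0 ⊢
  set x := rMinus M a Λ with hx
  set y := rPlus M a Λ with hy
  set zc := rCosmo M a Λ with hzc
  have hxy : (x : ℂ) - y ≠ 0 := by exact_mod_cast (show x - y ≠ 0 by linarith)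
  have hxz : (x : ℂ) - zc ≠ 0 := by exact_mod_cast (show x - zc ≠ 0 by linarith)
  have hyz : (y : ℂ) - zc ≠ 0 := by exact_mod_cast (show y - zc ≠ 0 by linarith)
  have hzy : (zc : ℂ) - y ≠ 0 := by exact_mod_cast (show zc - y ≠ 0 by linarith)
  have hyx : (y : ℂ) - x ≠ 0 := by exact_mod_cast (show y - x ≠ 0 by linarith)
  have hzx : (zc : ℂ) - x ≠ 0 := by exact_mod_cast (show zc - x ≠ 0 by linarith)
  have hxw : (x : ℂ) - -(x + y + zc) ≠ 0 := by exact_mod_cast (show x - -(x + y + zc) ≠ 0 by linarith)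
  have hyw : (y : ℂ) - -(x + y + zc) ≠ 0 := by exact_mod_cast (show y - -(x + y + zc) ≠ 0 by linarith)
  have hzw : (zc : ℂ) - -(x + y + zc) ≠ 0 := by exact_mod_cast (show zc - -(x + y + zc) ≠ 0 by linarith)
  have hwx : (-(x + y + zc) : ℂ) - x ≠ 0 := by exact_mod_cast (show -(x + y + zc) - x ≠ 0 by linarith)
  have hwy : (-(x + y + zc) : ℂ) - y ≠ 0 := by exact_mod_cast (show -(x + y + zc) - y ≠ 0 by linarith)
  have hwz : (-(x + y + zc) : ℂ) - zc ≠ 0 := by exact_mod_cast (show -(x + y + zc) - zc ≠ 0 by linarith)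
  have hrx : (r : ℂ) - x ≠ 0 := by exact_mod_cast (show r - x ≠ 0 by linarith)
  have hry : (r : ℂ) - y ≠ 0 := by exact_mod_cast (show r - y ≠ 0 by linarith)
  have hrz : (r : ℂ) - zc ≠ 0 := by exact_mod_cast (show r - zc ≠ 0 by linarith)
  have hrw : (r : ℂ) - -(x + y + zc) ≠ 0 := by exact_mod_cast (show r - -(x + y + zc) ≠ 0 by linarith)
  have hrw2 : (r : ℂ) + x + y + zc ≠ 0 := by exact_mod_cast (show r + x + y + zc ≠ 0 by linarith)
  have hΛ' : (Λ : ℂ) ≠ 0 := by exact_mod_cast hΛ.ne'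
  push_cast
  field_simp
  ring

/-- `heunLDeriv` is the derivative of `heunL` on `(r₊, r_c)`. [cite: Hatsuda2020, (2.17)–(2.18)] -/
theorem hasDerivAt_heunL {M a Λ : ℝ} (hsub : IsSubextremal M a Λ) (s : ℝ) (ω : ℂ) (m : ℝ) {r : ℝ}
    (hr : r ∈ Ioo (rPlus M a Λ) (rCosmo M a Λ)) :
    HasDerivAt (heunL M a Λ s ω m) (heunLDeriv M a Λ s ω m r) r := by
  obtain ⟨hΛ, h01, h12, hw0, hr1, hr2, hΔpos⟩ := root_facts hsub hr
  have hΔ : (delta M a Λ r : ℂ) ≠ 0 := by exact_mod_cast hΔpos.ne'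
  have hrx : ((r - rMinus M a Λ : ℝ) : ℂ) ≠ 0 := by
    exact_mod_cast (show r - rMinus M a Λ ≠ 0 by linarith)
  have h1 : HasDerivAt (fun t : ℝ => ((t ^ 2 + a ^ 2 : ℝ) : ℂ))
      ((((2 : ℕ) : ℝ) * r ^ (2 - 1) : ℝ) : ℂ) r :=
    ((hasDerivAt_pow 2 r).add_const (a ^ 2)).ofReal_comp
  have hK : HasDerivAt (fun t : ℝ => radialK a ω m t)
      (ω * ((((2 : ℕ) : ℝ) * r ^ (2 - 1) : ℝ) : ℂ)) r := by
    unfold radialK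
    exact (h1.const_mul ω).sub_const _
  have hD : HasDerivAt (fun t : ℝ => (delta M a Λ t : ℂ)) ((deltaDeriv M a Λ r : ℝ) : ℂ) r :=
    (hasDerivAt_delta M a Λ r).ofReal_comp
  have hS : HasDerivAt (fun t : ℝ => ((t - rMinus M a Λ : ℝ) : ℂ)) ((1 : ℝ) : ℂ) r :=
    ((hasDerivAt_id r).sub_const (rMinus M a Λ)).ofReal_comp
  have hA := (hK.const_mul (I * (xi a Λ : ℂ))).div hD hΔ
  have hB := (hasDerivAt_const r (2 * (s : ℂ) + 1)).div hS hrx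
  have h := hA.sub hB
  have e : heunL M a Λ s ω m = fun t =>
      I * (xi a Λ : ℂ) * radialK a ω m t / (delta M a Λ t : ℂ) -
        (2 * (s : ℂ) + 1) / ((t - rMinus M a Λ : ℝ) : ℂ) := by
    funext t; unfold heunL; push_cast; rfl
  rw [e]
  refine h.congr_deriv ?_
  unfold heunLDeriv
  push_cast
  field_simp
  ring

/-- The cancellation behind the zeroth-order identity, for ANY non-vanishing `D` in place of `Δ_r` and
any `D'` in place of `Δ_r'` (it uses only `K' = 2ωr`): with `L = iΞK/D − (2s+1)/(r−x)`,
`L' = iΞ(2ωrD − KD')/D² + (2s+1)/(r−x)²` and `V = [Ξ²K² − isΞKD']/D + 4isΞωr − (2Λ/3)(s+1)(2s+1)r²`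
`+ 2s(1−α) − λ`, the `Ξ²K²/D` and `ΞKD'/D` terms cancel:
`D(L²+L') + (s+1)D'L + V = −2iΞ(2s+1)(ω(rx+a²) − am)/(r−x) + (s+1)(2s+1)[2D/(r−x)² − D'/(r−x) − (2Λ/3)r²]`
`+ 2s(1−α) − λ`. [cite: Hatsuda2020, (2.13)–(2.19)] -/
theorem heun_low_cancel (ξ sR x a' : ℝ) (ωc amc D D' : ℂ) (r : ℝ) (hD : D ≠ 0)
    (hrx : (r : ℂ) - x ≠ 0) :
    let K : ℂ := ωc * ((r : ℂ) ^ 2 + (a' : ℂ) ^ 2) - amc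
    let L : ℂ := I * ξ * K / D - (2 * sR + 1) / ((r : ℂ) - x)
    let L' : ℂ := I * ξ * (2 * ωc * r * D - K * D') / D ^ 2 + (2 * sR + 1) / ((r : ℂ) - x) ^ 2
    D * (L ^ 2 + L') + (sR + 1) * D' * L + ((ξ ^ 2 * K ^ 2 - I * sR * ξ * K * D') / D) =
      -2 * I * ξ * (2 * sR + 1) * (ωc * ((r : ℂ) * x + (a' : ℂ) ^ 2) - amc) / ((r : ℂ) - x) -
        4 * I * sR * ξ * ωc * r +
        (sR + 1) * (2 * sR + 1) * (2 * D / ((r : ℂ) - x) ^ 2 - D' / ((r : ℂ) - x)) := by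
  intro K L L'
  simp only [K, L, L']
  field_simp
  ring_nf
  simp only [Complex.I_sq]
  ring

/-! ### The three coefficient identities -/

section Identities

variable {M a Λ : ℝ} (hsub : IsSubextremal M a Λ) (s : ℝ) (ω : ℂ) (m : ℝ) (lam : ℂ) {r : ℝ}
  (hr : r ∈ Ioo (rPlus M a Λ) (rCosmo M a Λ))

include hsub hr

/-- **Second-order coefficient**: `Δ_r z'² = Φ · z(z−1)(z−z_r)`. [cite: Hatsuda2020, (2.15)–(2.19)] -/
theorem heun_lead_identity :
    (delta M a Λ r : ℂ) * (mobiusZDeriv M a Λ r : ℂ) ^ 2 =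
      (heunPhi M a Λ : ℂ) * GeneralHeun.lead (mobiusZr M a Λ : ℂ) (mobiusZ M a Λ r) := by
  have hΔ := delta_eq_prod hsub r
  unfold GeneralHeun.lead mobiusZr mobiusZ mobiusZDeriv heunPhi
  rw [hΔ]
  obtain ⟨hΛ, h01, h12, hw0, hr1, hr2, hΔpos⟩ := root_facts hsub hr
  have hw : rNeg M a Λ = -(rMinus M a Λ + rPlus M a Λ + rCosmo M a Λ) := rfl
  rw [hw] at hw0 ⊢
  set x := rMinus M a Λ with hx
  set y := rPlus M a Λ with hy
  set zc := rCosmo M a Λ with hzc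
  have hxy : (x : ℂ) - y ≠ 0 := by exact_mod_cast (show x - y ≠ 0 by linarith)
  have hxz : (x : ℂ) - zc ≠ 0 := by exact_mod_cast (show x - zc ≠ 0 by linarith)
  have hyz : (y : ℂ) - zc ≠ 0 := by exact_mod_cast (show y - zc ≠ 0 by linarith)
  have hzy : (zc : ℂ) - y ≠ 0 := by exact_mod_cast (show zc - y ≠ 0 by linarith)
  have hyx : (y : ℂ) - x ≠ 0 := by exact_mod_cast (show y - x ≠ 0 by linarith)
  have hzx : (zc : ℂ) - x ≠ 0 := by exact_mod_cast (show zc - x ≠ 0 by linarith)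
  have hxw : (x : ℂ) - -(x + y + zc) ≠ 0 := by exact_mod_cast (show x - -(x + y + zc) ≠ 0 by linarith)
  have hyw : (y : ℂ) - -(x + y + zc) ≠ 0 := by exact_mod_cast (show y - -(x + y + zc) ≠ 0 by linarith)
  have hzw : (zc : ℂ) - -(x + y + zc) ≠ 0 := by exact_mod_cast (show zc - -(x + y + zc) ≠ 0 by linarith)
  have hwx : (-(x + y + zc) : ℂ) - x ≠ 0 := by exact_mod_cast (show -(x + y + zc) - x ≠ 0 by linarith)
  have hwy : (-(x + y + zc) : ℂ) - y ≠ 0 := by exact_mod_cast (show -(x + y + zc) - y ≠ 0 by linarith)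
  have hwz : (-(x + y + zc) : ℂ) - zc ≠ 0 := by exact_mod_cast (show -(x + y + zc) - zc ≠ 0 by linarith)
  have hrx : (r : ℂ) - x ≠ 0 := by exact_mod_cast (show r - x ≠ 0 by linarith)
  have hry : (r : ℂ) - y ≠ 0 := by exact_mod_cast (show r - y ≠ 0 by linarith)
  have hrz : (r : ℂ) - zc ≠ 0 := by exact_mod_cast (show r - zc ≠ 0 by linarith)
  have hrw : (r : ℂ) - -(x + y + zc) ≠ 0 := by exact_mod_cast (show r - -(x + y + zc) ≠ 0 by linarith)
  have hrw2 : (r : ℂ) + x + y + zc ≠ 0 := by exact_mod_cast (show r + x + y + zc ≠ 0 by linarith)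
  have hΛ' : (Λ : ℂ) ≠ 0 := by exact_mod_cast hΛ.ne'
  push_cast
  field_simp
  ring

/-- **First-order coefficient**: `Δ_r z'' + (2Δ_r L + (s+1)Δ_r') z' = Φ·[γ(z−1)(z−z_r) + δz(z−z_r) + εz(z−1)]`
— the `(z − z_∞)`-terms cancel (`2(2s+1) − 4(s+1) + 2 = 0`) and `2iΞK` is recovered from its values
at the three roots `r₊, r_c, r₋'` (Lagrange interpolation of a quadratic). [cite: Hatsuda2020, (2.19)–(2.20)] -/
theorem heun_mid_identity :
    (delta M a Λ r : ℂ) * (mobiusZDeriv2 M a Λ r : ℂ) +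
        (2 * (delta M a Λ r : ℂ) * heunL M a Λ s ω m r +
          ((s + 1 : ℝ) : ℂ) * (deltaDeriv M a Λ r : ℂ)) * (mobiusZDeriv M a Λ r : ℂ) =
      (heunPhi M a Λ : ℂ) *
        GeneralHeun.mid (mobiusZr M a Λ : ℂ) (heunGamma M a Λ s ω m) (heunDelta M a Λ s ω m)
          (heunEps M a Λ s ω m) (mobiusZ M a Λ r) := by
  have hd := deltaDeriv_eq_prod hsub r
  have hΔ := delta_eq_prod hsub r
  have hdy := deltaDeriv_at_rPlus hsub
  have hdz := deltaDeriv_at_rCosmo hsub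
  have hdw := deltaDeriv_at_rNeg hsub
  unfold GeneralHeun.mid heunGamma heunDelta heunEps mobiusZr mobiusZ mobiusZDeriv mobiusZDeriv2
    heunPhi heunL horizonB radialK
  rw [hdy, hdz, hdw, hd, hΔ]
  obtain ⟨hΛ, h01, h12, hw0, hr1, hr2, hΔpos⟩ := root_facts hsub hr
  have hw : rNeg M a Λ = -(rMinus M a Λ + rPlus M a Λ + rCosmo M a Λ) := rfl
  rw [hw] at hw0 ⊢
  set x := rMinus M a Λ with hx
  set y := rPlus M a Λ with hy
  set zc := rCosmo M a Λ with hzc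
  have hxy : (x : ℂ) - y ≠ 0 := by exact_mod_cast (show x - y ≠ 0 by linarith)
  have hxz : (x : ℂ) - zc ≠ 0 := by exact_mod_cast (show x - zc ≠ 0 by linarith)
  have hyz : (y : ℂ) - zc ≠ 0 := by exact_mod_cast (show y - zc ≠ 0 by linarith)
  have hzy : (zc : ℂ) - y ≠ 0 := by exact_mod_cast (show zc - y ≠ 0 by linarith)
  have hyx : (y : ℂ) - x ≠ 0 := by exact_mod_cast (show y - x ≠ 0 by linarith)
  have hzx : (zc : ℂ) - x ≠ 0 := by exact_mod_cast (show zc - x ≠ 0 by linarith)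
  have hxw : (x : ℂ) - -(x + y + zc) ≠ 0 := by exact_mod_cast (show x - -(x + y + zc) ≠ 0 by linarith)
  have hyw : (y : ℂ) - -(x + y + zc) ≠ 0 := by exact_mod_cast (show y - -(x + y + zc) ≠ 0 by linarith)
  have hzw : (zc : ℂ) - -(x + y + zc) ≠ 0 := by exact_mod_cast (show zc - -(x + y + zc) ≠ 0 by linarith)
  have hwx : (-(x + y + zc) : ℂ) - x ≠ 0 := by exact_mod_cast (show -(x + y + zc) - x ≠ 0 by linarith)
  have hwy : (-(x + y + zc) : ℂ) - y ≠ 0 := by exact_mod_cast (show -(x + y + zc) - y ≠ 0 by linarith)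
  have hwz : (-(x + y + zc) : ℂ) - zc ≠ 0 := by exact_mod_cast (show -(x + y + zc) - zc ≠ 0 by linarith)
  have hrx : (r : ℂ) - x ≠ 0 := by exact_mod_cast (show r - x ≠ 0 by linarith)
  have hry : (r : ℂ) - y ≠ 0 := by exact_mod_cast (show r - y ≠ 0 by linarith)
  have hrz : (r : ℂ) - zc ≠ 0 := by exact_mod_cast (show r - zc ≠ 0 by linarith)
  have hrw : (r : ℂ) - -(x + y + zc) ≠ 0 := by exact_mod_cast (show r - -(x + y + zc) ≠ 0 by linarith)
  have hrw2 : (r : ℂ) + x + y + zc ≠ 0 := by exact_mod_cast (show r + x + y + zc ≠ 0 by linarith)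
  have hΛ' : (Λ : ℂ) ≠ 0 := by exact_mod_cast hΛ.ne'
  push_cast
  field_simp
  ring

/-- **Zeroth-order coefficient**: `Δ_r(L² + L') + (s+1)Δ_r'L + V = Φ · (σ₊σ₋ z + v)` with
`V = radialPotential` (STU (3.7) = Hatsuda (2.13)). After `heun_low_cancel` the two sides are
`const + C/(r − r₋)`: the `r²`-terms cancel against `(2Λ/3)(s+1)(2s+1)r²` — the apparent singularity of
(2.13) at `r = ∞` (`z = z_∞`) is removed by the factor `(z−z_∞)^{2s+1}`. No Vieta relation beyond the
product forms of `Δ_r`, `Δ_r'` is used: the `a²`, `am`, `Ξ`, `1−α` and `λ` terms match symbol by symbol.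
[cite: Hatsuda2020, (2.19)–(2.21)] -/
theorem heun_low_identity :
    (delta M a Λ r : ℂ) * (heunL M a Λ s ω m r ^ 2 + heunLDeriv M a Λ s ω m r) +
        ((s + 1 : ℝ) : ℂ) * (deltaDeriv M a Λ r : ℂ) * heunL M a Λ s ω m r +
        radialPotential M a Λ s ω m lam r =
      (heunPhi M a Λ : ℂ) *
        GeneralHeun.low (heunSigmaPlus s) (heunSigmaMinus M a Λ s ω m) (heunV M a Λ s ω m lam)
          (mobiusZ M a Λ r) := by
  have hd := deltaDeriv_eq_prod hsub r
  have hΔ := delta_eq_prod hsub r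
  have hdx := deltaDeriv_at_rMinus hsub
  have hΔpos' := (root_facts hsub hr).2.2.2.2.2.2
  have hD : (delta M a Λ r : ℂ) ≠ 0 := by exact_mod_cast hΔpos'.ne'
  have hrx' : (r : ℂ) - (rMinus M a Λ : ℝ) ≠ 0 := by
    have := (root_facts hsub hr).2.1
    have h2 := (root_facts hsub hr).2.2.2.2.1
    exact_mod_cast (show r - rMinus M a Λ ≠ 0 by linarith)
  -- Step 1: the cancellation (generic in `Δ_r`, `Δ_r'`)
  have hc := heun_low_cancel (xi a Λ) s (rMinus M a Λ) a ω (((a * m : ℝ) : ℂ))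
    (delta M a Λ r : ℂ) (deltaDeriv M a Λ r : ℂ) r hD hrx'
  simp only at hc
  have hL : heunL M a Λ s ω m r =
      I * (xi a Λ) * (ω * ((r : ℂ) ^ 2 + (a : ℂ) ^ 2) - ((a * m : ℝ) : ℂ)) / (delta M a Λ r : ℂ) -
        (2 * s + 1) / ((r : ℂ) - (rMinus M a Λ : ℝ)) := by
    unfold heunL radialK; push_cast; ring
  have hL' : heunLDeriv M a Λ s ω m r =
      I * (xi a Λ) * (2 * ω * r * (delta M a Λ r : ℂ) -
          (ω * ((r : ℂ) ^ 2 + (a : ℂ) ^ 2) - ((a * m : ℝ) : ℂ)) * (deltaDeriv M a Λ r : ℂ)) /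
          (delta M a Λ r : ℂ) ^ 2 + (2 * s + 1) / ((r : ℂ) - (rMinus M a Λ : ℝ)) ^ 2 := by
    unfold heunLDeriv radialK; push_cast; ring
  have hV : radialPotential M a Λ s ω m lam r =
      ((xi a Λ : ℂ) ^ 2 * (ω * ((r : ℂ) ^ 2 + (a : ℂ) ^ 2) - ((a * m : ℝ) : ℂ)) ^ 2 -
          I * s * (xi a Λ) * (ω * ((r : ℂ) ^ 2 + (a : ℂ) ^ 2) - ((a * m : ℝ) : ℂ)) *
            (deltaDeriv M a Λ r : ℂ)) / (delta M a Λ r : ℂ) +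
        4 * I * s * (xi a Λ) * ω * r - ((2 * Λ / 3 * (s + 1) * (2 * s + 1) * r ^ 2 : ℝ) : ℂ) +
        ((2 * s * (1 - alpha a Λ) : ℝ) : ℂ) - lam := by
    unfold radialPotential radialK; push_cast; ring
  have step1 : (delta M a Λ r : ℂ) * (heunL M a Λ s ω m r ^ 2 + heunLDeriv M a Λ s ω m r) +
      ((s + 1 : ℝ) : ℂ) * (deltaDeriv M a Λ r : ℂ) * heunL M a Λ s ω m r +
      radialPotential M a Λ s ω m lam r =
      -2 * I * (xi a Λ) * (2 * s + 1) *
            (ω * ((r : ℂ) * (rMinus M a Λ : ℝ) + (a : ℂ) ^ 2) - ((a * m : ℝ) : ℂ)) /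
          ((r : ℂ) - (rMinus M a Λ : ℝ)) +
        (s + 1) * (2 * s + 1) *
          (2 * (delta M a Λ r : ℂ) / ((r : ℂ) - (rMinus M a Λ : ℝ)) ^ 2 -
            (deltaDeriv M a Λ r : ℂ) / ((r : ℂ) - (rMinus M a Λ : ℝ))) -
        ((2 * Λ / 3 * (s + 1) * (2 * s + 1) * r ^ 2 : ℝ) : ℂ) +
        ((2 * s * (1 - alpha a Λ) : ℝ) : ℂ) - lam := by
    rw [hL, hL', hV]
    push_cast at hc ⊢
    linear_combination hc
  rw [step1]
  -- Step 2: product forms and the remaining (small) identity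
  unfold GeneralHeun.low heunSigmaPlus heunSigmaMinus heunV heunPhi mobiusZ horizonB radialK
  rw [hdx, hd, hΔ]
  obtain ⟨hΛ, h01, h12, hw0, hr1, hr2, hΔpos⟩ := root_facts hsub hr
  have hw : rNeg M a Λ = -(rMinus M a Λ + rPlus M a Λ + rCosmo M a Λ) := rfl
  rw [hw] at hw0 ⊢
  set x := rMinus M a Λ with hx
  set y := rPlus M a Λ with hy
  set zc := rCosmo M a Λ with hzc
  have hxy : (x : ℂ) - y ≠ 0 := by exact_mod_cast (show x - y ≠ 0 by linarith)
  have hxz : (x : ℂ) - zc ≠ 0 := by exact_mod_cast (show x - zc ≠ 0 by linarith)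
  have hyz : (y : ℂ) - zc ≠ 0 := by exact_mod_cast (show y - zc ≠ 0 by linarith)
  have hzy : (zc : ℂ) - y ≠ 0 := by exact_mod_cast (show zc - y ≠ 0 by linarith)
  have hyx : (y : ℂ) - x ≠ 0 := by exact_mod_cast (show y - x ≠ 0 by linarith)
  have hzx : (zc : ℂ) - x ≠ 0 := by exact_mod_cast (show zc - x ≠ 0 by linarith)
  have hxw : (x : ℂ) - -(x + y + zc) ≠ 0 := by exact_mod_cast (show x - -(x + y + zc) ≠ 0 by linarith)
  have hyw : (y : ℂ) - -(x + y + zc) ≠ 0 := by exact_mod_cast (show y - -(x + y + zc) ≠ 0 by linarith)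
  have hzw : (zc : ℂ) - -(x + y + zc) ≠ 0 := by exact_mod_cast (show zc - -(x + y + zc) ≠ 0 by linarith)
  have hwx : (-(x + y + zc) : ℂ) - x ≠ 0 := by exact_mod_cast (show -(x + y + zc) - x ≠ 0 by linarith)
  have hwy : (-(x + y + zc) : ℂ) - y ≠ 0 := by exact_mod_cast (show -(x + y + zc) - y ≠ 0 by linarith)
  have hwz : (-(x + y + zc) : ℂ) - zc ≠ 0 := by exact_mod_cast (show -(x + y + zc) - zc ≠ 0 by linarith)
  have hrx : (r : ℂ) - x ≠ 0 := by exact_mod_cast (show r - x ≠ 0 by linarith)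
  have hry : (r : ℂ) - y ≠ 0 := by exact_mod_cast (show r - y ≠ 0 by linarith)
  have hrz : (r : ℂ) - zc ≠ 0 := by exact_mod_cast (show r - zc ≠ 0 by linarith)
  have hrw : (r : ℂ) - -(x + y + zc) ≠ 0 := by exact_mod_cast (show r - -(x + y + zc) ≠ 0 by linarith)
  have hrw2 : (r : ℂ) + x + y + zc ≠ 0 := by exact_mod_cast (show r + x + y + zc ≠ 0 by linarith)
  have hΛ' : (Λ : ℂ) ≠ 0 := by exact_mod_cast hΛ.ne'
  push_cast
  field_simp
  ring

end Identities

end Literature.Geometry.Lorentzian.KerrDeSitter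

end
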